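import Summits.Ventures.LatticeQCDFlow.Scaling.SwapLadderDEOBarrier
import Summits.Ventures.LatticeQCDFlow.Scaling.SwapAcceptanceOptimum

/-!
HONEST FRAMING: exact (Metropolis-corrected) sampling algorithms for lattice gauge theory; figures
of merit are autocorrelation/cost numbers at stated couplings and volumes; no continuum-physics
claim.

# SwapLadderDEOBarrierRoundTrip — UNDER THE DRIVER's DETERMINISTIC EVEN–ODD SCHEME THE MODEL ROUND TRIP OF A
# FLAT GAUSSIAN LADDER GROWS ONLY LINEARLY IN THE REPLICA COUNT AT FIXED STIFFNESS (`/(2(K+1)) → 1 + Λ/√(2π)`,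
# PER-SCAN ROUND-TRIP RATE `→ 1/(2 + 2Λ/√(2π)) > 0`), AGAINST QUADRATICALLY (RATE `→ 0`) FOR A REVERSIBLE
# SWAP SCHEME; S2's NUMBERS (row 22 `su3-ptbc`, GEN-6, ours; part 2 of 2, sequel of `SwapLadderDEOBarrier`)

Venture `LatticeQCDFlow` (cell pub-lqcd), topic `Scaling`; FANOUT row 22 (`su3-ptbc`, PTBC comparator arm E4).
NEW WORK of the cell over part 1 (`deoBarrier`, `deoBarrier_strictAntiOn`, `tendsto_deoBarrier`, `lt_deoBarrier`,
the brackets) and GEN-4's `SwapAcceptanceOptimum` (`uTwenty`, `erfc uTwenty = 1/5`) / `SwapSpacingBrackets`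
(`1.12836 < 2/√π < 1.128382`).  Nothing is cited as a fact; no `native_decide`.  Model and dictionary as in part 1
(`c = Λ/(2√2)`, flat `K`-interval ladder, pair acceptance `erfc(c/K)`; GEN-5's `SwapLadderRoundTripDEO`: DEO round
trip `2(K+1)(1 + Σ_i r_i/s_i)` scans, reversible (SEO) `2(K+1)(K + Σ_i r_i/s_i)` =
`2·SwapLadderRoundTripSpacing.uniformRT Λ (Λ/K)`, not re-declared — the SEO expressions below are written out).

## What is proved

§5 `deoRT c K = 2(K+1)(1 + deoBarrier c K)` (`_eq_flat`: GEN-5's `deo_round_trip_const` shape);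
   **`deoRT_le_mul` / `deoRT_lt_mul`** — for `1 ≤ K₀ ≤ K`, `deoRT c K ≤ ((K+1)/(K₀+1))·deoRT c K₀` (strict if
   `K₀ < K`): multiplying the replica count by `m` multiplies the DEO model round trip by LESS than `m`;
   **`lt_deoRT`** (`2(K+1)(1 + 2c/√π) < deoRT`), `deoRT_le`, **`tendsto_deoRT_div`** (`deoRT/(2(K+1)) → 1 + 2c/√π
   = 1 + Λ/√(2π)`); reversible scheme: `seoRT_sub_deoRT` (`= 2(K+1)(K−1)`, GEN-5's identity at model level),
   **`le_seoRT`** (`≥ 2K(K+1)`), `tendsto_seoRT_div_atTop`; `barrier_mem_Icc_observables` — the barrier lies between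
   two ladder observables, `Σ_i r_i ≤ Λ/√(2π) < Σ_i r_i/s_i` (S2 model: `9.6 ≤ · < 48`); the per-scan round-trip RATES of the `K+1`
   exchangeable replicas — Syed–Bouchard-Côté–Deligiannidis–Doucet (JRSS-B 84 (2022) 321 = arXiv:1905.02939,
   Theorem 3, read this seat: (a) `Λ ≤ E(P_N) = Σ_i r_i/s_i → Λ`, (b) `τ_SEO ∼ 1/(2N + 2Λ) → 0`,
   (c) `τ_DEO → τ̄ = 1/(2 + 2Λ) > 0`; "adding more cores … will never be harmful, but does have a diminishing
   return") in this model, NAMED ONLY — (a) is part 1's `lt_deoBarrier`/`tendsto_deoBarrier` with `Λ = Λ_stiff/√(2π)`,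
   (b)/(c) are **`tendsto_seo_rate`** (`(K+1)/(2(K+1)(K + Σ r/s)) → 0`) and **`tendsto_deo_rate`**
   (`(K+1)/deoRT → 1/(2 + 2Λ/√(2π)) > 0`, `deo_rate_limit_pos`).
§6 S2 (CARD §2: `N_r = 13` replicas, flat `20 %`; `K = 12`, `cTwenty = 12·uTwenty`): `swapRejOdds_uTwenty = 4`,
   **`deoBarrier_twenty = 48`**, **`deoRT_twenty = 1274`** scans (GEN-5's number), `seoRT_twenty = 1560`;
   **`barrier_twenty_bounds`** `12.18 < Λ/√(2π) < 13.55`; **`deoRT_twenty_le`** (`≤ 98(K+1)`, `K ≥ 12`) and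
   **`deoRT_twenty_gt`** (`> 26.36(K+1)`); **`deoRT_twenty_48`** — quadrupling S2's replicas gives
   `1274 < deoRT cTwenty 48 ≤ 4802` while the reversible scheme at `K = 48` needs `≥ 4704` (vs `1560`).

`deoRT c K` is also `N̄/τ` of their §5.3 (`k` copies of an `(N+1)`-chain PT on `N̄` cores: total round-trip rate
`τ = N̄/(2(N+1)(1 + E))`), so minimising `deoRT c ·` at fixed stiffness IS their chain-count optimisation —
linearised there (`r* = Λ/N`: `N* = 2Λ`, `r* ≈ 1/2`), exact in this model in GEN-5's `SwapAcceptanceOptimumDEO`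
(`uDeo ∈ (0.58, 0.63)`); NAMED ONLY.

READING FOR ROW 22 (CARD §1.5 `replicas.n` / the `N_r(20 %)` law; model only): over-provisioning replicas beyond
GEN-4's law is never free (`deoRT` has the floor `2(K+1)(1 + Λ/√(2π))`) but under the driver's scheme it is
LINEAR with slope below `deoRT(K₀)/(K₀+1)` from any anchor, each extra replica lowering `Σ r/s`; under a
reversible scheme the same surplus is quadratic.  The fixed-`Λ` optimum is GEN-5's `SwapAcceptanceOptimumDEO`
(`uDeo ∈ (0.58, 0.63)`, acceptance `≈ 0.39`); this file bounds the penalty on the high-`K` side.  NOT CLAIMED: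
that PTBC obeys the model or 'efficient local exploration'; non-flat ladders; autocorrelation times; run numbers.
-/

noncomputable section

open Real Set Filter Topology
open Literature.Analysis.SpecialFunctions (erf)
open Literature.ComputerArithmetic.BrentZimmermann2010.AsymptoticExpansions (erfc erfc_pos)

namespace Summit.Ventures.LatticeQCDFlow.Scaling

/-! ## §5 Round trips: linear (DEO, the driver's scheme) versus quadratic (reversible) growth in `K` -/

section RoundTrip

/-- **The DEO model round trip of the flat Gaussian ladder** (scans): `deoRT c K = 2(K+1)(1 + Σ_i r_i/s_i)`.
[ours] -/
def deoRT (c : ℝ) (K : ℕ) : ℝ := 2 * ((K : ℝ) + 1) * (1 + deoBarrier c K)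

/-- The shape of GEN-5's `deo_round_trip_const`: `2(K+1)(1 + K(1 − a)/a)`, `a = erfc(c/K)`. [ours] -/
theorem deoRT_eq_flat (c : ℝ) (K : ℕ) :
    deoRT c K = 2 * ((K : ℝ) + 1) * (1 + K * ((1 - erfc (c / K)) / erfc (c / K))) := by
  rw [deoRT, deoBarrier_eq_flat]

/-- `0 < deoRT c K` (`c ≥ 0`). [ours] -/
theorem deoRT_pos {c : ℝ} (hc : 0 ≤ c) (K : ℕ) : 0 < deoRT c K := by
  have h := deoBarrier_nonneg hc K
  unfold deoRT
  positivity

/-- **Linear envelope from any anchor**: for `1 ≤ K₀ ≤ K`, `deoRT c K ≤ ((K+1)/(K₀+1))·deoRT c K₀` — multiplying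
the replica count by `m` multiplies the DEO model round trip by at most (in fact less than) `m`. [ours] -/
theorem deoRT_le_mul {c : ℝ} (hc : 0 < c) {K₀ K : ℕ} (h₀ : 1 ≤ K₀) (h : K₀ ≤ K) :
    deoRT c K ≤ ((K : ℝ) + 1) / ((K₀ : ℝ) + 1) * deoRT c K₀ := by
  have hmono : deoBarrier c K ≤ deoBarrier c K₀ :=
    (deoBarrier_strictAntiOn hc).antitoneOn (show (1 : ℕ) ≤ K₀ from h₀) (show (1 : ℕ) ≤ K from h₀.trans h) h
  have hK₀ : (0 : ℝ) < (K₀ : ℝ) + 1 := by positivity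
  have hK : (0 : ℝ) < (K : ℝ) + 1 := by positivity
  unfold deoRT
  rw [show ((K : ℝ) + 1) / ((K₀ : ℝ) + 1) * (2 * ((K₀ : ℝ) + 1) * (1 + deoBarrier c K₀))
      = 2 * ((K : ℝ) + 1) * (1 + deoBarrier c K₀) by field_simp]
  have : 0 ≤ 2 * ((K : ℝ) + 1) := by positivity
  exact mul_le_mul_of_nonneg_left (by linarith) this

/-- Strict version for `K₀ < K`: the slope is strictly sub-proportional. [ours] -/
theorem deoRT_lt_mul {c : ℝ} (hc : 0 < c) {K₀ K : ℕ} (h₀ : 1 ≤ K₀) (h : K₀ < K) :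
    deoRT c K < ((K : ℝ) + 1) / ((K₀ : ℝ) + 1) * deoRT c K₀ := by
  have hmono : deoBarrier c K < deoBarrier c K₀ :=
    deoBarrier_strictAntiOn hc (show (1 : ℕ) ≤ K₀ from h₀) (show (1 : ℕ) ≤ K from h₀.trans h.le) h
  have hK₀ : (0 : ℝ) < (K₀ : ℝ) + 1 := by positivity
  unfold deoRT
  rw [show ((K : ℝ) + 1) / ((K₀ : ℝ) + 1) * (2 * ((K₀ : ℝ) + 1) * (1 + deoBarrier c K₀))
      = 2 * ((K : ℝ) + 1) * (1 + deoBarrier c K₀) by field_simp]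
  have : 0 < 2 * ((K : ℝ) + 1) := by positivity
  exact mul_lt_mul_of_pos_left (by linarith) this

/-- **Floor**: `2(K+1)(1 + 2c/√π) < deoRT c K` for `K ≥ 1`, `c > 0`. [ours] -/
theorem lt_deoRT {c : ℝ} (hc : 0 < c) {K : ℕ} (hK : 1 ≤ K) :
    2 * ((K : ℝ) + 1) * (1 + 2 / sqrt π * c) < deoRT c K := by
  have h := lt_deoBarrier hc hK
  have : 0 < 2 * ((K : ℝ) + 1) := by positivity
  unfold deoRT
  exact mul_lt_mul_of_pos_left (by linarith) this

/-- **Ceiling**: `deoRT c K ≤ 2(K+1)(1 + (2c/√π)/(1 − 2c/(√π K)))` once `K > 2c/√π`. [ours] -/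
theorem deoRT_le {c : ℝ} (hc : 0 ≤ c) {K : ℕ} (hK : 2 / sqrt π * c < K) :
    deoRT c K ≤ 2 * ((K : ℝ) + 1) * (1 + (2 / sqrt π * c) / (1 - 2 / sqrt π * c / K)) := by
  have h := deoBarrier_le hc hK
  have : 0 ≤ 2 * ((K : ℝ) + 1) := by positivity
  unfold deoRT
  exact mul_le_mul_of_nonneg_left (by linarith) this

/-- **Per-replica round trip → `1 + 2c/√π = 1 + Λ/√(2π)`**. [ours] -/
theorem tendsto_deoRT_div {c : ℝ} (hc : 0 ≤ c) :
    Tendsto (fun K : ℕ => deoRT c K / (2 * ((K : ℝ) + 1))) atTop (𝓝 (1 + 2 / sqrt π * c)) := by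
  have h := (tendsto_const_nhds (x := (1 : ℝ))).add (tendsto_deoBarrier hc)
  refine h.congr fun K => ?_
  have : (2 : ℝ) * ((K : ℝ) + 1) ≠ 0 := by positivity
  unfold deoRT
  field_simp

/-- **The barrier is bracketed by two ladder observables** (model): the total rejection `Σ_i r_i = K·erf(c/K)`
under-states `2c/√π = Λ/√(2π)` (`erf x ≤ 2x/√π`) while `Σ_i r_i/s_i` over-states it (`lt_deoBarrier`):
`K·erf(c/K) ≤ Λ/√(2π) < deoBarrier c K` (`K ≥ 1`, `c > 0`). [ours] -/
theorem barrier_mem_Icc_observables {c : ℝ} (hc : 0 < c) {K : ℕ} (hK : 1 ≤ K) :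
    (K : ℝ) * erf (c / K) ≤ 2 / sqrt π * c ∧ 2 / sqrt π * c < deoBarrier c K := by
  refine ⟨?_, lt_deoBarrier hc hK⟩
  have hK0 : (0 : ℝ) < K := by exact_mod_cast hK
  have h := erf_le_two_div_sqrt_pi_mul (div_nonneg hc.le hK0.le)
  calc (K : ℝ) * erf (c / K) ≤ K * (2 / sqrt π * (c / K)) := mul_le_mul_of_nonneg_left h hK0.le
    _ = 2 / sqrt π * c := by field_simp

/-- GEN-5's identity at the model level: reversible minus DEO `= 2(K+1)(K−1)`. [ours] -/
theorem seoRT_sub_deoRT (c : ℝ) (K : ℕ) :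
    2 * ((K : ℝ) + 1) * (K + deoBarrier c K) - deoRT c K = 2 * ((K : ℝ) + 1) * (K - 1) := by
  unfold deoRT; ring

/-- **Quadratic floor for the reversible scheme**: `2K(K+1) ≤ 2(K+1)(K + Σ_i r_i/s_i)`. [ours] -/
theorem le_seoRT {c : ℝ} (hc : 0 ≤ c) (K : ℕ) :
    2 * (K : ℝ) * (K + 1) ≤ 2 * ((K : ℝ) + 1) * (K + deoBarrier c K) := by
  have h := deoBarrier_nonneg hc K
  nlinarith

/-- The reversible per-replica round trip `K + Σ_i r_i/s_i` diverges. [ours] -/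
theorem tendsto_seoRT_div_atTop {c : ℝ} (hc : 0 ≤ c) :
    Tendsto (fun K : ℕ => 2 * ((K : ℝ) + 1) * (K + deoBarrier c K) / (2 * ((K : ℝ) + 1))) atTop atTop := by
  have h : Tendsto (fun K : ℕ => (K : ℝ) + deoBarrier c K) atTop atTop :=
    tendsto_natCast_atTop_atTop.atTop_add_nonneg fun K => deoBarrier_nonneg hc K
  refine h.congr fun K => ?_
  have : (2 : ℝ) * ((K : ℝ) + 1) ≠ 0 := by positivity
  field_simp

/-- **Per-scan round-trip rate of the `K+1` exchangeable replicas under DEO**: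
`(K+1)/deoRT c K → 1/(2(1 + 2c/√π)) > 0` (Syed et al.'s `τ̄ → 1/(2+2Λ)` in this model). [ours] -/
theorem tendsto_deo_rate {c : ℝ} (hc : 0 ≤ c) :
    Tendsto (fun K : ℕ => ((K : ℝ) + 1) / deoRT c K) atTop (𝓝 (1 / (2 * (1 + 2 / sqrt π * c)))) := by
  have hA : (2 : ℝ) * (1 + 2 / sqrt π * c) ≠ 0 := by positivity
  have h := ((tendsto_deoBarrier hc).const_add 1).const_mul 2
  have h2 := (tendsto_const_nhds (x := (1 : ℝ))).div h hA
  refine h2.congr fun K => ?_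
  have hK : (K : ℝ) + 1 ≠ 0 := by positivity
  have hB : 1 + deoBarrier c K ≠ 0 := by linarith [deoBarrier_nonneg hc K]
  simp only [Pi.div_apply, deoRT]
  field_simp

/-- The DEO rate limit is positive. [ours] -/
theorem deo_rate_limit_pos {c : ℝ} (hc : 0 ≤ c) : 0 < 1 / (2 * (1 + 2 / sqrt π * c)) := by positivity

/-- **Under the reversible scheme the per-scan round-trip rate vanishes**: `(K+1)/(2(K+1)(K + Σ r/s)) → 0`. [ours] -/
theorem tendsto_seo_rate {c : ℝ} (hc : 0 ≤ c) :
    Tendsto (fun K : ℕ => ((K : ℝ) + 1) / (2 * ((K : ℝ) + 1) * (K + deoBarrier c K))) atTop (𝓝 0) := by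
  have h : Tendsto (fun K : ℕ => 2 * ((K : ℝ) + deoBarrier c K)) atTop atTop :=
    (tendsto_natCast_atTop_atTop.atTop_add_nonneg fun K => deoBarrier_nonneg hc K).const_mul_atTop two_pos
  have h2 := tendsto_inv_atTop_zero.comp h
  refine h2.congr' ?_
  filter_upwards [eventually_ge_atTop 1] with K hK1
  have hK : (0 : ℝ) < (K : ℝ) + 1 := by positivity
  have hB : 0 < (K : ℝ) + deoBarrier c K := by
    have := deoBarrier_nonneg hc K
    have : (1 : ℝ) ≤ K := by exact_mod_cast hK1
    linarith
  simp only [Function.comp_apply]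
  field_simp

end RoundTrip

/-! ## §6 S2's numbers (`K = 12`, flat `20 %`): model orientation only -/

section Twenty

/-- S2's reduced total stiffness in the model: twelve intervals at the `20 %` spacing `uTwenty`. [ours] -/
def cTwenty : ℝ := 12 * uTwenty

/-- `cTwenty > 0`. [ours] -/
theorem cTwenty_pos : 0 < cTwenty := by
  unfold cTwenty; linarith [uTwenty_mem_Ioo.1]

/-- `r/s = 4` at `20 %` acceptance. [ours] -/
theorem swapRejOdds_uTwenty : swapRejOdds uTwenty = 4 := by
  rw [swapRejOdds_eq_inv_sub, erfc_uTwenty]; norm_num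

/-- **`Σ_i r_i/s_i = 48` at S2's point** (`12` pairs × `4`). [ours] -/
theorem deoBarrier_twenty : deoBarrier cTwenty 12 = 48 := by
  unfold deoBarrier cTwenty
  rw [show (12 : ℝ) * uTwenty / ((12 : ℕ) : ℝ) = uTwenty by push_cast; ring, swapRejOdds_uTwenty]
  norm_num

/-- **S2's DEO model round trip `= 2·13·49 = 1274` scans** (GEN-5's number, in this file's variables). [ours] -/
theorem deoRT_twenty : deoRT cTwenty 12 = 1274 := by
  rw [deoRT, deoBarrier_twenty]; norm_num

/-- S2's reversible model round trip would be `2·13·(12 + 48) = 1560` scans. [ours] -/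
theorem seoRT_twenty : 2 * (((12 : ℕ) : ℝ) + 1) * ((12 : ℕ) + deoBarrier cTwenty 12) = 1560 := by
  rw [deoBarrier_twenty]; norm_num

/-- **The barrier at S2's stiffness: `12.18 < 2·cTwenty/√π = Λ/√(2π) < 13.55`** (`0.9 < uTwenty < 1`,
`1.12836 < 2/√π < 1.128382`). [ours] -/
theorem barrier_twenty_bounds : (12.18 : ℝ) < 2 / sqrt π * cTwenty ∧ 2 / sqrt π * cTwenty < 13.55 := by
  have hu := uTwenty_mem_Ioo
  have h1 := lt_two_div_sqrt_pi
  have h2 := two_div_sqrt_pi_lt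
  unfold cTwenty
  constructor <;> nlinarith [hu.1, hu.2]

/-- **Linear envelope at S2's stiffness**: `deoRT cTwenty K ≤ 98(K+1)` for every `K ≥ 12`. [ours] -/
theorem deoRT_twenty_le {K : ℕ} (hK : 12 ≤ K) : deoRT cTwenty K ≤ 98 * ((K : ℝ) + 1) := by
  have h := deoRT_le_mul cTwenty_pos (show 1 ≤ 12 by norm_num) hK
  rw [deoRT_twenty] at h
  have e : ((K : ℝ) + 1) / (((12 : ℕ) : ℝ) + 1) * 1274 = 98 * ((K : ℝ) + 1) := by push_cast; ring
  rwa [e] at h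

/-- **Floor at S2's stiffness**: `26.36(K+1) < deoRT cTwenty K` for every `K ≥ 1`. [ours] -/
theorem deoRT_twenty_gt {K : ℕ} (hK : 1 ≤ K) : 26.36 * ((K : ℝ) + 1) < deoRT cTwenty K := by
  have h := lt_deoRT cTwenty_pos hK
  have hb := barrier_twenty_bounds.1
  have hK0 : (0 : ℝ) < (K : ℝ) + 1 := by positivity
  nlinarith

/-- **Quadrupling S2's replicas (K = 48) lengthens the DEO model round trip — but by a bounded factor:
`1274 < 1291.64 < deoRT cTwenty 48 ≤ 4802`**; the reversible scheme at `K = 48` needs `≥ 2·48·49 = 4704`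
scans against its `1560` at `K = 12`. [ours] -/
theorem deoRT_twenty_48 :
    deoRT cTwenty 12 < deoRT cTwenty 48 ∧ deoRT cTwenty 48 ≤ 4802 ∧
      (4704 : ℝ) ≤ 2 * (((48 : ℕ) : ℝ) + 1) * ((48 : ℕ) + deoBarrier cTwenty 48) := by
  refine ⟨?_, ?_, ?_⟩
  · have h := deoRT_twenty_gt (show 1 ≤ 48 by norm_num)
    rw [deoRT_twenty]
    push_cast at h
    linarith
  · have h := deoRT_twenty_le (show 12 ≤ 48 by norm_num)
    push_cast at h
    linarith
  · have h := le_seoRT cTwenty_pos.le 48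
    push_cast at h ⊢
    linarith

end Twenty

end Summit.Ventures.LatticeQCDFlow.Scaling
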